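import Summits.ABC.IUTFork.Cor312PinnedGapNotNecessary
import Summits.ABC.IUTFork.Cor312PinnedRegionsThreePins
import HarnessLib

/-!
# [IUTchIII] Cor. 3.12 under the THREE PINS: identification ⊊ containment ⊊ volume inequality — the hull census

Record-only file (D-0012) of the abc-iut cell (PINNED-REGIONS ROUND, director-abc 2026-08-26T02:18:52Z addendum (pL),
`HOME/plan/ADJUDICATION-SPEC.md` v2.3 §2 (G-PINNED-2); seat abc-iut-w5-d232, gen 2; sequel of
`Cor312PinnedGapNotNecessary`); TAKES NO SIDE on [IUTchIII] Cor. 3.12; proof-only apart from one toy exponent vector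
(`expOneFive`); no `Prop` fact.

Over the exponent family `expSetting p e` (q-datum `{(±q^{e_j})_j}`, abc-iut-w5-d247's `withQDatum`, abc-iut-w5-d230's
`ballOfMonoid`) the THREE pins of abc-iut-w5-d230's `Cor312PinnedRegionsThreePins` (p418935) hold for every `e` — the link pin
(pL) `LinkPinned := Thm311ToCor312.PilotLink` DEGENERATELY, both pilot-object types of the `toySig` settings being one-point
(`expSetting_linkPinned`; to be SAID, as w5-d230 notes for the same reason) — and the three printed-level residuals line up
as a STRICT chain of conditions on the ONE uninterpreted datum (`pinned3_exponent_census`, every prime `p`, every `e`):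

* identification: READING R3 ⟺ `GapA3` ⟺ `e = (1, 4)`;
* containment: abc-iut-c312-1's (xi-f) `Licence` (q-region inside the holomorphic hull at every `j ∈ 𝔽_l^⋇`, S. Mochizuki,
  *Inter-universal Teichmüller theory III*, kurims `paper:url-4b091feeb646`, p. 184 l. 19–29 «the inclusion
  `−|log(q)| ∈ ℝ_{≤−|log(Θ)|}` … then follows formally») ⟺ `GapH3` ⟺ `e₁ ≥ 1 ∧ e₂ ≥ 4` (`jsq j ≤ e_j` at every label);
* volume inequality: the typed Corollary 3.12 ⟺ `e₁ + e₂ ≥ 5`.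
Strictness, at the INFLATION-FREE valuation frame (hull of a ball = the ball): `e = (1, 5)` has the Licence (hence the
Corollary) WITHOUT R3 (`expOneFive_licence_not_reading3`); `e = (3, 3)` (P♮) has the Corollary WITHOUT the Licence
(`expThree_statement_not_licence`: at `j = 2` the q-ball `B_3` is NOT inside the hull `B_4`, the deficit being paid for by
`j = 1` in the procession AVERAGE).  So under all three pins even the HULL-level residual `GapH3` is SUFFICIENT
(`statement_of_gapH3`) and NOT NECESSARY for the Corollary: the printed conclusion compares procession-averaged
log-volumes, the (xi-f) licence is a per-label containment (`pinned3_hierarchy_strict`).  Complements abc-iut-w4-d103's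
`Cor312PinnedRegionsHonest`/`…HonestWitness` (honest q-volume, Licence obtained from an INFLATING frame).
HONEST SCOPE: interface/toy level (one place, `l⋇ = 2`, one-point strip slots, formal ball volumes, degenerate (pL));
nothing about initial Θ-data; no judgement on print. [claim: Mochizuki2012, status: disputed]
[cite: ScholzeStix2018, §2.2 pp. 9–10]
-/

noncomputable section

namespace Summit.ABC

namespace IUTFork

namespace Cor312Vol

namespace NaiveWitness

open Thm311 Cor312 Cor312.Checks Cor312.IdentifiedNonVacuity Literature.IUT.LogThetaLattice GluedMonoids.Naive

variable (p : ℕ) [hp : Fact p.Prime] (e : toyIndex.LabelStar → ℕ)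

/-! ## 1. The third pin and the three-pin identification gap -/

/-- **(pL) holds — DEGENERATELY**: both pilot-object types of the `toySig` settings are the one-point type, so the identity
identifies them carrying Θ-pilot to q-pilot.  (Said, not hidden: the contentful (pL) with honest objects is
abc-iut-w4-d101's `Cor312PinnedSetting`/`…Operators`.) [claim: Mochizuki2012, status: disputed] -/
theorem expSetting_linkPinned : LinkPinned (naiveFull p).toLatticeSituation (expSetting p e) :=
  linkPinned_of_equiv _ _ (Equiv.refl _) (Subsingleton.elim (α := Unit) _ _)

/-- **The THREE pins hold for every exponent vector.** [claim: Mochizuki2012, status: disputed] -/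
theorem expSetting_pinnedRegions3 :
    PinnedRegions3 (naiveFull p).toLatticeSituation (expSetting p e) (ballOfMonoid p) fun v _ => qDatumExp p e v :=
  ⟨expSetting_pinnedRegions p e, expSetting_linkPinned p e⟩

/-- **`GapA3` (identification under three pins) ⟺ `e = (1, 4)`.** [claim: Mochizuki2012, status: disputed] -/
theorem expSetting_gapA3_iff :
    GapA3 (naiveFull p).toLatticeSituation (expSetting p e) (ballOfMonoid p) (fun v _ => qDatumExp p e v) ↔
      e ⟨1, by decide⟩ = 1 ∧ e ⟨2, by decide⟩ = 4 :=
  (gapA3_iff_gapA''_of_linkPinned _ _ _ _ (expSetting_linkPinned p e)).trans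
    ((expSetting_gapA''_iff p e).trans (expSetting_reading3_iff' p e))

/-! ## 2. The hull-level residual: the (xi-f) licence -/

/-- The holomorphic hull at `(j, v_ℚ)` is `B_{j²}` (abc-iut-w5-d247). [folklore] -/
theorem expSetting_thetaHull (j : toyIndex.Label) (vQ : toyIndex.VQ) :
    (expSetting p e).thetaHull j vQ = pBall p j vQ (jsq j) :=
  withQDatum_thetaHull p _ _ j vQ

/-- **The (xi-f) LICENCE under the pins ⟺ `j² ≤ e_j` at every label** (`B_{e_j} ⊆ B_{j²}`). [claim: Mochizuki2012, status: disputed] -/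
theorem expSetting_licence_iff :
    Thm311ToCor312.Licence (expSetting p e) ↔ ∀ j : toyIndex.LabelStar, jsq j.1 ≤ (e j : ℤ) := by
  constructor
  · intro h j
    have hi := h (j.1.pred j.2) ()
    have hj : Setting.labelSucc (T := toyIndex) (j.1.pred j.2) = j.1 := Fin.succ_pred j.1 j.2
    rw [hj] at hi
    rw [expSetting_qRegion, expAt_of_ne_zero e j.2, expSetting_thetaHull, pBall_subset_iff] at hi
    exact hi
  · intro h i vQ
    rw [expSetting_qRegion, expAt_of_ne_zero e (Setting.labelSucc_ne_zero i), expSetting_thetaHull, pBall_subset_iff]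
    exact h ⟨_, Setting.labelSucc_ne_zero i⟩

/-- **The LICENCE under the pins ⟺ `e₁ ≥ 1 ∧ e₂ ≥ 4`.** [claim: Mochizuki2012, status: disputed] -/
theorem expSetting_licence_iff' :
    Thm311ToCor312.Licence (expSetting p e) ↔ 1 ≤ e ⟨1, by decide⟩ ∧ 4 ≤ e ⟨2, by decide⟩ := by
  rw [expSetting_licence_iff]
  have hj1 : jsq (1 : toyIndex.Label) = 1 := by decide
  have hj2 : jsq (2 : toyIndex.Label) = 4 := by decide
  constructor
  · intro h
    have h1 := h ⟨1, by decide⟩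
    have h2 := h ⟨2, by decide⟩
    rw [hj1] at h1
    rw [hj2] at h2
    constructor <;> omega
  · rintro ⟨h1, h2⟩ j
    rcases labelStar_cases j with rfl | rfl
    · rw [hj1]; exact_mod_cast h1
    · rw [hj2]; exact_mod_cast h2

/-- **`GapH3` (the hull-level residual under three pins) ⟺ the LICENCE** (the pins hold). [claim: Mochizuki2012, status: disputed] -/
theorem expSetting_gapH3_iff :
    GapH3 (naiveFull p).toLatticeSituation (expSetting p e) (ballOfMonoid p) (fun v _ => qDatumExp p e v) ↔
      Thm311ToCor312.Licence (expSetting p e) :=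
  ⟨fun h => h (expSetting_pinnedRegions3 p e), fun h _ => h⟩

/-! ## 3. Strictness of the chain -/

/-- The exponent vector `(1, 5)`: q-datum `{±q, ±q⁵}`. [claim: Mochizuki2012, status: disputed] -/
def expOneFive : toyIndex.LabelStar → ℕ := fun j => if j.1 = 1 then 1 else 5

omit hp in
/-- `(1, 5)` evaluated. [folklore] -/
theorem expOneFive_eval : expOneFive ⟨1, by decide⟩ = 1 ∧ expOneFive ⟨2, by decide⟩ = 5 :=
  ⟨if_pos rfl, if_neg (by decide)⟩

/-- **`(1, 5)`: CONTAINMENT WITHOUT IDENTIFICATION** — the Licence (hence `GapH3` and the typed Corollary) holds, READING R3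
(hence `GapA3`, `GapA″`, `IdentifiedReading`) fails. [folklore] -/
theorem expOneFive_licence_not_reading3 :
    Thm311ToCor312.Licence (expSetting p expOneFive) ∧ (expSetting p expOneFive).Statement ∧
      ¬ (∀ (j : toyIndex.Label) (vQ : toyIndex.VQ),
          (expSetting p expOneFive).qRegion j vQ ∈ (expSetting p expOneFive).possibleImages j vQ) ∧
      ¬ GapA3 (naiveFull p).toLatticeSituation (expSetting p expOneFive) (ballOfMonoid p)
          (fun v _ => qDatumExp p expOneFive v) := by
  obtain ⟨h1, h2⟩ := expOneFive_eval
  have hL : Thm311ToCor312.Licence (expSetting p expOneFive) :=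
    (expSetting_licence_iff' p _).2 ⟨by omega, by omega⟩
  refine ⟨hL, Thm311ToCor312.statement_of_licence (expSetting_bridgeHyps p _) hL, ?_, ?_⟩
  · rw [expSetting_reading3_iff']
    omega
  · rw [expSetting_gapA3_iff]
    omega

/-- **`(3, 3)` (P♮): VOLUME INEQUALITY WITHOUT CONTAINMENT** — the typed Corollary holds (strictly) while the (xi-f) Licence
FAILS (at `j = 2`: `B_3 ⊄ B_4`; the procession average is rescued by `j = 1`), hence `¬GapH3`. [folklore] -/
theorem expThree_statement_not_licence :
    (expSetting p expThree).Statement ∧ ¬ Thm311ToCor312.Licence (expSetting p expThree) ∧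
      ¬ GapH3 (naiveFull p).toLatticeSituation (expSetting p expThree) (ballOfMonoid p)
          (fun v _ => qDatumExp p expThree v) := by
  have hL : ¬ Thm311ToCor312.Licence (expSetting p expThree) := by
    rw [expSetting_licence_iff']
    rintro ⟨-, h2⟩
    exact absurd h2 (by decide)
  exact ⟨(expThree_statement_strict p).1, hL, fun h => hL ((expSetting_gapH3_iff p _).1 h)⟩

/-! ## 4. The census theorems for the (G-PINNED-2) record -/

/-- **THE THREE-PIN HIERARCHY IS STRICT.**  Over abc-iut-w5-d247's contentful naive model with abc-iut-w5-d230's operator,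
for every situation/setting/operator/datum the chain R3 ⟹ Licence ⟹ Statement holds under the three pins and the bridge
hypotheses (`gapH3_of_gapA3`, `statement_of_gapH3`, p418935); and there are pin-respecting (three pins) settings over ONE
contentful typed-Thm-3.11 instance with every bridge hypothesis and `|log(q)| > 0` realising «Licence ∧ ¬R3» and
«Statement ∧ ¬Licence».  So neither print's (xi-e)/(xi-f) identification (`GapA3`) nor its hull-level licence (`GapH3`)
is NECESSARY for the typed Corollary under the pins; both are sufficient.  Interface/toy level; no side taken. [folklore] -/
theorem pinned3_hierarchy_strict :
    ∃ (T : ThetaIndex) (F : FullSituation T)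
      (ρ : (∀ v : T.V, v ∈ T.Vbad → Set (F.L.StarPacket v)) → ∀ (j : T.Label) (vQ : T.VQ), Set (F.L.Packet j vQ))
      (qK₁ qK₂ : ∀ v : T.V, v ∈ T.Vbad → Set (F.L.StarPacket v)) (P₁ P₂ : Setting F.toLatticeSituation.toSituation),
      F.Statement ∧ (∀ (n : ℤ) (v : T.V) (hv : v ∈ T.Vbad), ((F.D n).Ψ v hv).Nonempty) ∧
      (PinnedRegions3 F.toLatticeSituation P₁ ρ qK₁ ∧ BridgeHyps P₁ ∧ P₁.AbsLogQPos ∧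
        Thm311ToCor312.Licence P₁ ∧ GapH3 F.toLatticeSituation P₁ ρ qK₁ ∧ P₁.Statement ∧
        ¬ (∀ (j : T.Label) (vQ : T.VQ), P₁.qRegion j vQ ∈ P₁.possibleImages j vQ) ∧
        ¬ GapA3 F.toLatticeSituation P₁ ρ qK₁) ∧
      (PinnedRegions3 F.toLatticeSituation P₂ ρ qK₂ ∧ BridgeHyps P₂ ∧ P₂.AbsLogQPos ∧ P₂.Statement ∧
        ¬ Thm311ToCor312.Licence P₂ ∧ ¬ GapH3 F.toLatticeSituation P₂ ρ qK₂) := by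
  haveI : Fact (Nat.Prime 2) := ⟨Nat.prime_two⟩
  obtain ⟨hL, hS, hR, hG⟩ := expOneFive_licence_not_reading3 2
  obtain ⟨hS', hL', hH'⟩ := expThree_statement_not_licence 2
  exact ⟨toyIndex, naiveFull 2, ballOfMonoid 2, (fun v _ => qDatumExp 2 expOneFive v),
    (fun v _ => qDatumExp 2 expThree v), expSetting 2 expOneFive, expSetting 2 expThree, naiveFull_statement 2,
    fun _ v _ => ⟨thetaValues 2 v, thetaValues_mem_Psi 2 v⟩,
    ⟨expSetting_pinnedRegions3 2 _, expSetting_bridgeHyps 2 _,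
      expSetting_absLogQPos 2 _ (by rw [esum, expOneFive_eval.1, expOneFive_eval.2]; decide), hL,
      (expSetting_gapH3_iff 2 _).2 hL, hS, hR, hG⟩,
    ⟨expSetting_pinnedRegions3 2 _, expSetting_bridgeHyps 2 _, expThree_absLogQPos 2, hS', hL', hH'⟩⟩

/-- **THE THREE-PIN EXPONENT CENSUS** (every prime `p`, every `e = (e₁, e₂)`): the three pins and every bridge hypothesis
ALWAYS hold; `GapA3` ⟺ `e = (1, 4)`; `GapH3` ⟺ Licence ⟺ `e₁ ≥ 1 ∧ e₂ ≥ 4`; the typed Corollary ⟺ `e₁ + e₂ ≥ 5` —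
identification pins EACH exponent, containment BOUNDS EACH exponent below, the Corollary bounds their SUM.
Interface/toy level; no side taken. [claim: Mochizuki2012, status: disputed] -/
theorem pinned3_exponent_census :
    PinnedRegions3 (naiveFull p).toLatticeSituation (expSetting p e) (ballOfMonoid p) (fun v _ => qDatumExp p e v) ∧
      BridgeHyps (expSetting p e) ∧
      (GapA3 (naiveFull p).toLatticeSituation (expSetting p e) (ballOfMonoid p) (fun v _ => qDatumExp p e v) ↔
        e ⟨1, by decide⟩ = 1 ∧ e ⟨2, by decide⟩ = 4) ∧
      (GapH3 (naiveFull p).toLatticeSituation (expSetting p e) (ballOfMonoid p) (fun v _ => qDatumExp p e v) ↔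
        1 ≤ e ⟨1, by decide⟩ ∧ 4 ≤ e ⟨2, by decide⟩) ∧
      (Thm311ToCor312.Licence (expSetting p e) ↔ 1 ≤ e ⟨1, by decide⟩ ∧ 4 ≤ e ⟨2, by decide⟩) ∧
      ((expSetting p e).Statement ↔ 5 ≤ e ⟨1, by decide⟩ + e ⟨2, by decide⟩) :=
  ⟨expSetting_pinnedRegions3 p e, expSetting_bridgeHyps p e, expSetting_gapA3_iff p e,
    (expSetting_gapH3_iff p e).trans (expSetting_licence_iff' p e), expSetting_licence_iff' p e,
    expSetting_statement_iff p e⟩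

end NaiveWitness

end Cor312Vol

end IUTFork

end Summit.ABC

end
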